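import Literature.NumberTheory.Automorphic.SymplecticSimilitudeSphericalCharacters
import Literature.NumberTheory.Automorphic.SymplecticSatakeCountingImage
import HarnessLib

/-!
# The COUNTING Satake transform of `ℋ(GSp_{2n}(K), GSp_{2n}(𝒪); R)` identifies the Hecke algebra, over EVERY commutative ring `R`
# (no inverse of `q` needed), with the lattice of TWISTED Weyl invariants `f_{wλ} = q^{⟨ρ,λ₁⟩-⟨ρ,(wλ)₁⟩} f_λ`
# (Zhu 2020 §1.4; Treumann–Venkatesh 2016 §7.2; Gross 1998 (3.10)–(3.11); Andrianov–Zhuravlev Thm. 3.30 / Cartier Thm. 4.1)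

Topic `NumberTheory/Automorphic`; namespace `Literature.NumberTheory.Automorphic.SymplecticCartan` (lane `lit-hodgefound`,
Track 2 foundations; seat `lit-hodgefound-p11`, generation 51, row g51-#6).  DEFINITIONS with bodies (`similitudeTwistedTarget`, an
`R`-submodule of `R[ℤⁿ × ℤ]`; `similitudeTwistedDominantBelow`; `similitudeCountingSatakeLinearEquiv`) + theorems; no named fact, no
instance, no notation.  The `GSp_{2n}` twin of `SymplecticSatakeCountingImage` (g50-#8), on top of the counting identity of
`SymplecticSimilitudeSatakeWeylInvariance` (g51-#2) and the dominance/triangularity of `SymplecticSimilitudeSatakeIsomorphism` (g51-#4).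

## The mathematics

`G = GSp_{2n}(K)`, `K₀ = GSp_{2n}(𝒪)` (compact `𝒪`, residue cardinality `q`), `(a, c)(γ) ∈ ℤⁿ × ℤ` the Iwasawa exponents,
`W = W(GSp_{2n})`, `⟨ρ, μ⟩ = Σ_i (n-i) μ_i` (the weight of `GSp_{2n}` only reads the first component).  The COUNTING transform
`𝒮_1(T) = Σ_λ N_T(λ) x^λ` (weight `1`; `similitudeSatakeTransform hϖ 1`) is defined over `ℤ` and injective over every commutative `R`;
A–Z's/Cartier's transform is `𝒮_q = monomialTwist(q^{⟨ρ,·⟩}) ∘ 𝒮_1` and is `W`-invariant where `q` is a unit (g51-#2).  Clearing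
denominators gives an image description valid over EVERY `R` ([TreumannVenkatesh2016] §7.2, `(W, *)`-action; [ZhuIntegralSatake2020]
§1.4 `CT^{cl} : H_G ⥲ ℤ[X^•] ∩ ℚ[X^•]^{(W,•_ρ)}`; [GrossSatake1998] (3.10)–(3.11)):

  `𝒯_R = {f ∈ R[ℤⁿ × ℤ] : f_{wλ} = q^{⟨ρ,λ₁⟩-⟨ρ,(wλ)₁⟩} · f_λ for all w ∈ W and λ with ⟨ρ,(wλ)₁⟩ ≤ ⟨ρ,λ₁⟩}`   (`similitudeTwistedTarget R n q`).

THEOREM: **for every commutative ring `R`, `𝒮_1 : ℋ(GSp_{2n}(K), K₀; R) ⥲ 𝒯_R` is an isomorphism of `R`-modules**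
(`similitudeCountingSatakeLinearEquiv`); over `𝔽_p`, `p ∣ q`, `𝒯_{𝔽_p}` consists of the functions supported on the `⟨ρ,·⟩`-maximal
exponents of each `W`-orbit (Herzig's mod-`p` image shape, `mem_similitudeTwistedTarget_iff_of_cast_eq_zero`); when `(q : R)` is a unit,
`𝒯_R = monomialTwist⁻¹(R[ℤⁿ × ℤ]^W)` and `monomialTwist ∘ 𝒮_1 = similitudeSatakeAlgEquiv` (§5).
PROOF.  (⊆) The coefficients of `𝒮_1(T_g)` are the natural numbers `N_g(λ) = #{γ ⊆ K₀gK₀ : (a,c)(γ) = λ}` and the counting identity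
`N_g(wλ) q^{E⁺} = N_g(λ) q^{(-E)⁺}` of g51-#2 read from the dominant end is `N_g(wλ) = q^{⟨ρ,λ₁⟩-⟨ρ,(wλ)₁⟩} N_g(λ)`, an identity of
natural numbers that maps to every `R`.  (⊇) Cartier's triangular induction from the DOMINANT end, slice by slice in the multiplier
exponent `c`, where no division occurs: for `0 ≠ f ∈ 𝒯_R` and `(a, c) ∈ supp f` with `a` head-sum-maximal in its slice, the relations
force the slice of `supp f` to be stable under the `W`-moves that do not decrease `⟨ρ, ·⟩`; a transposition at an ascent or `τ_k` at
`2a_k < c` both increase `⟨ρ,·⟩` (`(n-k)(c - 2a_k) > 0`) and the head sums, so `a` is dominant; the counting transform of the Cartan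
operator `T_{t(c, a - c·1)}` has coefficient EXACTLY `1` at `x^{(a,c)}` (Bruhat–Tits (4.4.4) (ii)) and support dominated by `a` in the
slice `c`, so `f - f_{(a,c)} 𝒮_1(T_{t(c,a-c·1)}) ∈ 𝒯_R` has a strictly smaller `U(f)`; induct.

## What is formalised

* §1 `similitudeTwistedTarget R n b`, `mem_similitudeTwistedTarget_iff`, `similitudeSignedPermEquiv_symm_apply'`,
  **`coeff_ne_zero_similitudeSignedPerm_of_mem_twisted`** (support stability), `mem_similitudeTwistedTarget_iff_of_cast_eq_zero`.
* §2 `symplecticRhoPairing_tau_sub` (`⟨ρ,τ_kμ⟩ - ⟨ρ,μ⟩ = (n-k)(c-2μ_k)`), `similitudeSignedPermEquiv_one_apply`,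
  **`antitone_two_mul_ge_of_isMaxOn_of_mem_twisted`**.
* §3 **`card_filter_similitudeIwasawaExp_signedPerm_eq`** (`N_g(wλ) = q^{⟨ρ,λ₁⟩-⟨ρ,(wλ)₁⟩} N_g(λ)` in `ℕ`),
  **`similitudeSatakeTransform_one_mem_twisted`** (`𝒮_1(T) ∈ 𝒯_R`, every `R`).
* §4 `similitudeTwistedDominantBelow`, `finite_…`, **`exists_similitudeSatakeTransform_one_eq_of_mem_twisted`** (SURJECTIVITY),
  **`range_similitudeSatakeTransform_one_eq_twisted`**, **`similitudeCountingSatakeLinearEquiv : ℋ_R ≃ₗ[R] 𝒯_R`**, `…_apply`.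
* §5 **`mem_similitudeTwistedTarget_iff_monomialTwist_mem_weylInvariants`** (`𝒯_R = twist⁻¹(R[ℤⁿ × ℤ]^W)` when `q ∈ Rˣ`),
  `monomialTwist_similitudeCountingSatakeLinearEquiv` (`twist ∘ 𝒮_1 = 𝒮_q = similitudeSatakeAlgEquiv`).

## References
* [ZhuIntegralSatake2020] X. Zhu, *A note on integral Satake isomorphisms*, arXiv:2005.13056 (2020), §1.4.
* [TreumannVenkatesh2016] D. Treumann, A. Venkatesh, *Functoriality, Smith theory, and the Brauer homomorphism*, Ann. of Math. 183
  (2016), §7.2 (the twisted `W`-action, Theorem (i)).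
* [GrossSatake1998] B. H. Gross, *On the Satake isomorphism*, LMS Lecture Notes 254 (1998), (3.8)–(3.11), Prop. 3.6.
* [Herzig2010] F. Herzig, *A Satake isomorphism in characteristic p*, Compos. Math. 147 (2011), Thm. 1.2.
* [AndrianovZhuravlev1995] A. N. Andrianov, V. G. Zhuravlev, *Modular Forms and Hecke Operators* (1995), Ch. 3 §3.3 (3.51), Thm. 3.30.
* [CartierCorvallis1979] P. Cartier, *Representations of 𝔭-adic groups: a survey*, PSPM 33.1 (1979), §IV (4.2), Thm. 4.1.
* [BruhatTits1972] F. Bruhat, J. Tits, *Groupes réductifs sur un corps local I*, Publ. Math. IHÉS 41 (1972), (4.4.3), (4.4.4).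
-/

noncomputable section

open scoped Valued WithZero MatrixGroups
open Matrix MonoidAlgebra Representation

namespace Literature.NumberTheory.Automorphic.SymplecticCartan

open Literature.NumberTheory.Automorphic Literature.NumberTheory.Automorphic.CartanUnique
  Literature.NumberTheory.Automorphic.HermitianLattice

variable {R : Type*} [CommRing R] {n : ℕ}

/-! ## §1 The twisted invariants `𝒯_R ⊆ R[ℤⁿ × ℤ]` of `GSp_{2n}` -/

variable (R n) in
/-- **`𝒯_R ⊆ R[ℤⁿ × ℤ]`, the twisted `W(GSp_{2n})`-invariants**: `f_{wλ} = b^{⟨ρ,λ₁⟩-⟨ρ,(wλ)₁⟩} f_λ` for every `w = (ε, π) ∈ W(GSp_{2n})`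
and every `λ` with `⟨ρ, (wλ)₁⟩ ≤ ⟨ρ, λ₁⟩` (`b` = the residue cardinality; each pair constrained once, from its more dominant end).
[cite: TreumannVenkatesh2016, §7.2] [cite: ZhuIntegralSatake2020, §1.4] [cite: GrossSatake1998, (3.10)–(3.11)] -/
def similitudeTwistedTarget (b : ℕ) : Submodule R (AddMonoidAlgebra R ((Fin n → ℤ) × ℤ)) where
  carrier := {f | ∀ (lc : (Fin n → ℤ) × ℤ) (ε : Fin n → ℤˣ) (π : Equiv.Perm (Fin n)),
    symplecticRhoPairing (similitudeSignedPermEquiv ε π lc).1 ≤ symplecticRhoPairing lc.1 →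
      f.coeff (similitudeSignedPermEquiv ε π lc) =
        (b : R) ^ (symplecticRhoPairing lc.1 - symplecticRhoPairing (similitudeSignedPermEquiv ε π lc).1).toNat * f.coeff lc}
  add_mem' {f g} hf hg lc ε π h := by
    rw [AddMonoidAlgebra.coeff_add, Finsupp.add_apply, Finsupp.add_apply, hf lc ε π h, hg lc ε π h, mul_add]
  zero_mem' lc ε π h := by simp
  smul_mem' c f hf lc ε π h := by
    rw [AddMonoidAlgebra.coeff_smul, Finsupp.smul_apply, Finsupp.smul_apply, hf lc ε π h, smul_eq_mul, smul_eq_mul, mul_left_comm]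

/-- Membership in `𝒯_R`. [cite: TreumannVenkatesh2016, §7.2] -/
theorem mem_similitudeTwistedTarget_iff (b : ℕ) (f : AddMonoidAlgebra R ((Fin n → ℤ) × ℤ)) :
    f ∈ similitudeTwistedTarget R n b ↔ ∀ (lc : (Fin n → ℤ) × ℤ) (ε : Fin n → ℤˣ) (π : Equiv.Perm (Fin n)),
      symplecticRhoPairing (similitudeSignedPermEquiv ε π lc).1 ≤ symplecticRhoPairing lc.1 →
        f.coeff (similitudeSignedPermEquiv ε π lc) =
          (b : R) ^ (symplecticRhoPairing lc.1 - symplecticRhoPairing (similitudeSignedPermEquiv ε π lc).1).toNat * f.coeff lc :=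
  Iff.rfl

/-- **Inverting `(ε, π)`**: `(ε ∘ π⁻¹, π⁻¹)(w λ) = λ` for `w = (ε, π)`. [cite: AndrianovZhuravlev1995, Ch. 3 §3.3 (3.51)] -/
theorem similitudeSignedPermEquiv_symm_apply' (ε : Fin n → ℤˣ) (π : Equiv.Perm (Fin n)) (lc : (Fin n → ℤ) × ℤ) :
    similitudeSignedPermEquiv (fun j => ε (π.symm j)) π.symm (similitudeSignedPermEquiv ε π lc) = lc := by
  rw [← similitudeSignedPermEquiv_inv, ← LinearEquiv.mul_apply, inv_mul_cancel]
  rfl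

/-- **Support stability**: for `f ∈ 𝒯_R` with `f_λ ≠ 0`, every `wλ` with `⟨ρ, λ₁⟩ ≤ ⟨ρ, (wλ)₁⟩` lies in the support too.
[cite: TreumannVenkatesh2016, §7.2] -/
theorem coeff_ne_zero_similitudeSignedPerm_of_mem_twisted {b : ℕ} {f : AddMonoidAlgebra R ((Fin n → ℤ) × ℤ)}
    (hf : f ∈ similitudeTwistedTarget R n b) {lc : (Fin n → ℤ) × ℤ} (hμ : f.coeff lc ≠ 0) (ε : Fin n → ℤˣ) (π : Equiv.Perm (Fin n))
    (hρ : symplecticRhoPairing lc.1 ≤ symplecticRhoPairing (similitudeSignedPermEquiv ε π lc).1) :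
    f.coeff (similitudeSignedPermEquiv ε π lc) ≠ 0 := by
  intro h0
  have h := hf (similitudeSignedPermEquiv ε π lc) (fun j => ε (π.symm j)) π.symm
    (by rw [similitudeSignedPermEquiv_symm_apply']; exact hρ)
  rw [similitudeSignedPermEquiv_symm_apply', h0, mul_zero] at h
  exact hμ h

/-- **`𝒯_R` when `q = 0` in `R`** (e.g. `R = 𝔽_p`, `p ∣ q`): `f_{wλ} = 0` if `⟨ρ,(wλ)₁⟩ < ⟨ρ,λ₁⟩` and `f_{wλ} = f_λ` if they agree — the
functions supported on the `⟨ρ,·⟩`-maximal exponents of each `W`-orbit (Herzig's mod-`p` Satake image shape, trivial weight).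
[cite: Herzig2010, Thm. 1.2, Cor. 1.3] [cite: TreumannVenkatesh2016, §7.2] -/
theorem mem_similitudeTwistedTarget_iff_of_cast_eq_zero {b : ℕ} (hb : (b : R) = 0) (f : AddMonoidAlgebra R ((Fin n → ℤ) × ℤ)) :
    f ∈ similitudeTwistedTarget R n b ↔ ∀ (lc : (Fin n → ℤ) × ℤ) (ε : Fin n → ℤˣ) (π : Equiv.Perm (Fin n)),
      (symplecticRhoPairing (similitudeSignedPermEquiv ε π lc).1 < symplecticRhoPairing lc.1 →
        f.coeff (similitudeSignedPermEquiv ε π lc) = 0) ∧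
      (symplecticRhoPairing (similitudeSignedPermEquiv ε π lc).1 = symplecticRhoPairing lc.1 →
        f.coeff (similitudeSignedPermEquiv ε π lc) = f.coeff lc) := by
  rw [mem_similitudeTwistedTarget_iff]
  refine ⟨fun h lc ε π => ⟨fun hlt => ?_, fun heq => ?_⟩, fun h lc ε π hle => ?_⟩
  · rw [h lc ε π hlt.le, hb, zero_pow (by omega), zero_mul]
  · rw [h lc ε π heq.le, heq, sub_self, Int.toNat_zero, pow_zero, one_mul]
  · rcases hle.lt_or_eq with hlt | heq
    · rw [(h lc ε π).1 hlt, hb, zero_pow (by omega), zero_mul]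
    · rw [(h lc ε π).2 heq, heq, sub_self, Int.toNat_zero, pow_zero, one_mul]

/-! ## §2 A head-sum maximal element of a slice of the support of `f ∈ 𝒯_R` is dominant -/

/-- `⟨ρ, τ_k μ⟩ - ⟨ρ, μ⟩ = (n - k)(c - 2μ_k)` for `τ_k : μ_k ↦ c - μ_k`. [cite: TreumannVenkatesh2016, §7.2] [cite: AndrianovZhuravlev1995, Ch. 3 §3.3 (3.51)] -/
theorem symplecticRhoPairing_tau_sub (μ : Fin n → ℤ) (k : Fin n) (c : ℤ) :
    symplecticRhoPairing (similitudeSignedPermEquiv (signFlipAt k) 1 (μ, c)).1 - symplecticRhoPairing μ =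
      ((n : ℤ) - (k : ℕ)) * (c - 2 * μ k) := by
  classical
  rw [symplecticRhoPairing, symplecticRhoPairing, ← Finset.sum_sub_distrib,
    Finset.sum_eq_single_of_mem k (Finset.mem_univ _) fun i _ hi => ?_]
  · rw [similitudeSignedPermEquiv_apply]
    dsimp only
    rw [signFlipAt_self, if_neg (by decide), Equiv.Perm.coe_one, id]
    ring
  · rw [similitudeSignedPermEquiv_apply]
    dsimp only
    rw [signFlipAt_of_ne hi, if_pos rfl, Equiv.Perm.coe_one, id, sub_self]

/-- The permutation part of `W(GSp_{2n})`: `(1, π)(μ, c) = (μ ∘ π, c)`. [cite: AndrianovZhuravlev1995, Ch. 3 §3.3 (3.51)] -/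
theorem similitudeSignedPermEquiv_one_apply (π : Equiv.Perm (Fin n)) (μ : Fin n → ℤ) (c : ℤ) :
    similitudeSignedPermEquiv (fun _ => (1 : ℤˣ)) π (μ, c) = (μ ∘ π, c) := by
  rw [similitudeSignedPermEquiv_apply]
  refine Prod.ext (funext fun i => ?_) rfl
  dsimp only
  rw [if_pos rfl, Function.comp_apply]

/-- **A head-sum lexicographically maximal element of a multiplier slice of `supp f`, `f ∈ 𝒯_R`, is dominant** (antitone and
`2a_i ≥ c`): a transposition at an ascent, or `τ_k` at a coordinate with `2a_k < c`, increases both `⟨ρ,·⟩` (so stays in the support)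
and the head-sum vector. [cite: CartierCorvallis1979, §IV, proof of Thm. 4.1 (c)] [cite: TreumannVenkatesh2016, §7.2] -/
theorem antitone_two_mul_ge_of_isMaxOn_of_mem_twisted {b : ℕ} {f : AddMonoidAlgebra R ((Fin n → ℤ) × ℤ)}
    (hf : f ∈ similitudeTwistedTarget R n b) {a : Fin n → ℤ} {c : ℤ} (ha : f.coeff (a, c) ≠ 0)
    (hmax : ∀ μ, f.coeff (μ, c) ≠ 0 → toLex (headSumVec μ) ≤ toLex (headSumVec a)) :
    Antitone a ∧ ∀ i, c ≤ 2 * a i := by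
  constructor
  · intro i j hij
    by_contra hcon
    rw [not_le] at hcon
    have hne : i ≠ j := fun h => by rw [h] at hcon; exact lt_irrefl _ hcon
    have hlt : (i : ℕ) < (j : ℕ) := lt_of_le_of_ne (Fin.le_iff_val_le_val.1 hij) fun h => hne (Fin.ext h)
    have hb : f.coeff (a ∘ Equiv.swap i j, c) ≠ 0 := by
      have h := coeff_ne_zero_similitudeSignedPerm_of_mem_twisted hf ha (fun _ => 1) (Equiv.swap i j) (by
        rw [similitudeSignedPermEquiv_one_apply]
        have hs := symplecticRhoPairing_comp_swap_sub a hne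
        have : 0 ≤ (((j : ℕ) : ℤ) - (i : ℕ)) * (a j - a i) := mul_nonneg (by omega) (by omega)
        dsimp only
        omega)
      rwa [similitudeSignedPermEquiv_one_apply] at h
    refine absurd (hmax _ hb) (not_le.2 (toLex_headSumVec_lt i (fun r hr => ?_) ?_))
    · exact (headSum_comp_eq_of_forall_lt a _ r fun k hk =>
        Equiv.swap_apply_of_ne_of_ne (fun h => by rw [h] at hk; omega) (fun h => by rw [h] at hk; omega)).symm
    · rw [headSum_succ, headSum_succ, headSum_comp_eq_of_forall_lt a _ _ fun k hk =>
        Equiv.swap_apply_of_ne_of_ne (fun h => by rw [h] at hk; omega) (fun h => by rw [h] at hk; omega),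
        Function.comp_apply, Equiv.swap_apply_left]
      omega
  · intro k
    by_contra hcon
    rw [not_le] at hcon
    set bμ := (similitudeSignedPermEquiv (signFlipAt k) 1 (a, c)).1 with hbμ
    have hbk : bμ k = c - a k := by
      rw [hbμ, similitudeSignedPermEquiv_apply]; dsimp only
      rw [signFlipAt_self, if_neg (by decide), Equiv.Perm.coe_one, id]
    have hbi : ∀ i, i ≠ k → bμ i = a i := fun i hik => by
      rw [hbμ, similitudeSignedPermEquiv_apply]; dsimp only
      rw [signFlipAt_of_ne hik, if_pos rfl, Equiv.Perm.coe_one, id]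
    have hb : f.coeff (bμ, c) ≠ 0 := by
      have h := coeff_ne_zero_similitudeSignedPerm_of_mem_twisted hf ha (signFlipAt k) 1 (by
        have hs := symplecticRhoPairing_tau_sub a k c
        have hk := k.isLt
        have : 0 < ((n : ℤ) - (k : ℕ)) * (c - 2 * a k) := mul_pos (by omega) (by omega)
        dsimp only at hs ⊢
        omega)
      have he : similitudeSignedPermEquiv (signFlipAt k) 1 (a, c) = (bμ, c) := Prod.ext rfl rfl
      rwa [he] at h
    have heq : ∀ r : ℕ, r ≤ (k : ℕ) → headSum a r = headSum bμ r := fun r hr => by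
      refine Finset.sum_congr rfl fun i _ => ?_
      split_ifs with hi
      · exact (hbi i fun h => by rw [h] at hi; omega).symm
      · rfl
    refine absurd (hmax _ hb) (not_le.2 (toLex_headSumVec_lt k heq ?_))
    rw [headSum_succ, headSum_succ, ← heq k le_rfl, hbk]
    omega

/-! ## §3 The counting transform lands in `𝒯_R` -/

section Image

variable {K : Type*} [Field K] [Valued K ℤᵐ⁰] {ϖ : K} [NeZero n] [CompactSpace 𝒪[K]] [Finite 𝓀[K]]
  [IsHeckeTriple (⊤ : Submonoid (symplecticSimilitudeGroup (Fin n) K)) (symplecticSimilitudeInt (Fin n) K)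
    (symplecticSimilitudeInt (Fin n) K)]

/-- **`N(wλ) = q^{⟨ρ,λ₁⟩-⟨ρ,(wλ)₁⟩} · N(λ)` in `ℕ`** for `⟨ρ,(wλ)₁⟩ ≤ ⟨ρ,λ₁⟩` (`N(λ) = #{γ ⊆ K₀gK₀ : (a,c)(γ) = λ}`): the counting
identity of `SymplecticSimilitudeSatakeWeylInvariance` read from the dominant end. [cite: TreumannVenkatesh2016, §7.2]
[cite: CartierCorvallis1979, §IV (4.2), Thm. 4.1 (b)] -/
theorem card_filter_similitudeIwasawaExp_signedPerm_eq (hϖ : Valued.v ϖ = WithZero.exp (-1 : ℤ))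
    (g : symplecticSimilitudeGroup (Fin n) K) (lc : (Fin n → ℤ) × ℤ) (ε : Fin n → ℤˣ) (π : Equiv.Perm (Fin n))
    (hρ : symplecticRhoPairing (similitudeSignedPermEquiv ε π lc).1 ≤ symplecticRhoPairing lc.1)
    [DecidablePred fun γ : symplecticSimilitudeGroup (Fin n) K ⧸ symplecticSimilitudeInt (Fin n) K =>
      similitudeIwasawaExp hϖ γ.out = similitudeSignedPermEquiv ε π lc]
    [DecidablePred fun γ : symplecticSimilitudeGroup (Fin n) K ⧸ symplecticSimilitudeInt (Fin n) K =>
      similitudeIwasawaExp hϖ γ.out = lc] :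
    ((finite_orbit_quotient (symplecticSimilitudeInt (Fin n) K) g).toFinset.filter
        fun γ => similitudeIwasawaExp hϖ γ.out = similitudeSignedPermEquiv ε π lc).card =
      Nat.card 𝓀[K] ^ (symplecticRhoPairing lc.1 - symplecticRhoPairing (similitudeSignedPermEquiv ε π lc).1).toNat *
        ((finite_orbit_quotient (symplecticSimilitudeInt (Fin n) K) g).toFinset.filter
          fun γ => similitudeIwasawaExp hϖ γ.out = lc).card := by
  classical
  have h := card_filter_similitudeIwasawaExp_signedPerm_mul_pow_eq hϖ g ε π lc
  rw [show (symplecticRhoPairing (similitudeSignedPermEquiv ε π lc).1 - symplecticRhoPairing lc.1).toNat = 0 from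
      Int.toNat_eq_zero.2 (by omega), pow_zero, mul_one, mul_comm] at h
  convert h using 2

/-- **`𝒮_1(T) ∈ 𝒯_R` for every `T ∈ ℋ_R(GSp_{2n}(K), GSp_{2n}(𝒪))` and every commutative ring `R`** (from the double-coset operators,
whose counting coefficients are natural numbers, by linearity). [cite: TreumannVenkatesh2016, §7.2 Theorem (i)] [cite: ZhuIntegralSatake2020, §1.4]
[cite: GrossSatake1998, (3.10)–(3.11)] -/
theorem similitudeSatakeTransform_one_mem_twisted (hϖ : Valued.v ϖ = WithZero.exp (-1 : ℤ))
    (T : heckeAlgebra R (symplecticSimilitudeGroup (Fin n) K) (symplecticSimilitudeInt (Fin n) K)) :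
    similitudeSatakeTransform hϖ 1 T ∈ similitudeTwistedTarget R n (Nat.card 𝓀[K]) := by
  classical
  have hT := heckeAlgebra.mem_span_range_doubleCosetOperator (symplecticSimilitudeInt (Fin n) K) T
  induction hT using Submodule.span_induction with
  | mem S hS =>
    obtain ⟨g, rfl⟩ := hS
    intro lc ε π hρ
    rw [coeff_similitudeSatakeTransform_doubleCosetOperator, coeff_similitudeSatakeTransform_doubleCosetOperator, _root_.one_zpow,
      _root_.one_zpow, Units.val_one, mul_one, mul_one, card_filter_similitudeIwasawaExp_signedPerm_eq hϖ g lc ε π hρ, Nat.cast_mul,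
      Nat.cast_pow]
  | zero => exact Submodule.zero_mem _
  | add S S' _ _ hS hS' => rw [map_add]; exact Submodule.add_mem _ hS hS'
  | smul c S _ hS => rw [map_smul]; exact Submodule.smul_mem _ c hS

end Image

/-! ## §4 Surjectivity onto `𝒯_R` and the counting Satake isomorphism over every `R` -/

section Surjective

/-- `U(f)`: the dominant exponents `(μ, c)` lying below (same `c`, dominance order on `μ`) some dominant exponent of `supp f`.
[cite: CartierCorvallis1979, §IV, proof of Thm. 4.1 (c)] -/
def similitudeTwistedDominantBelow (f : AddMonoidAlgebra R ((Fin n → ℤ) × ℤ)) : Set ((Fin n → ℤ) × ℤ) :=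
  {lc | Antitone lc.1 ∧ (∀ i, lc.2 ≤ 2 * lc.1 i) ∧
    ∃ b : Fin n → ℤ, f.coeff (b, lc.2) ≠ 0 ∧ Antitone b ∧ ∀ r, headSum lc.1 r ≤ headSum b r}

/-- `U(f)` is finite. [cite: CartierCorvallis1979, §IV, proof of Thm. 4.1 (c)] -/
theorem finite_similitudeTwistedDominantBelow (f : AddMonoidAlgebra R ((Fin n → ℤ) × ℤ)) :
    (similitudeTwistedDominantBelow f).Finite := by
  refine Set.Finite.subset (Set.Finite.biUnion (Finset.finite_toSet f.coeff.support)
    fun bc _ => ((finite_setOf_antitone_two_mul_ge_headSum_le bc.1 bc.2).image fun la => (la, bc.2))) ?_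
  rintro ⟨la, c⟩ ⟨h1, h2, b, hb, -, hle⟩
  exact Set.mem_biUnion (Finsupp.mem_support_iff.2 hb) ⟨la, ⟨h1, h2, hle⟩, rfl⟩

variable {K : Type*} [Field K] [Valued K ℤᵐ⁰] {ϖ : K} [NeZero n] [CompactSpace 𝒪[K]] [Finite 𝓀[K]]
  [IsHeckeTriple (⊤ : Submonoid (symplecticSimilitudeGroup (Fin n) K)) (symplecticSimilitudeInt (Fin n) K)
    (symplecticSimilitudeInt (Fin n) K)]

/-- **SURJECTIVITY OF THE COUNTING TRANSFORM ONTO `𝒯_R`, EVERY COMMUTATIVE `R`** (Cartier's triangular induction from the dominant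
end, slice by slice in the multiplier exponent: the counting transform of `T_{t(m,a)}` has coefficient exactly `1` at `x^{(m+a, m)}`,
so no division is needed). [cite: ZhuIntegralSatake2020, §1.4] [cite: TreumannVenkatesh2016, §7.2 Theorem (i)] [cite: GrossSatake1998, (3.10)–(3.11)]
[cite: CartierCorvallis1979, §IV Thm. 4.1, proof (c)] -/
theorem exists_similitudeSatakeTransform_one_eq_of_mem_twisted (hϖ : Valued.v ϖ = WithZero.exp (-1 : ℤ))
    (f : AddMonoidAlgebra R ((Fin n → ℤ) × ℤ)) (hf : f ∈ similitudeTwistedTarget R n (Nat.card 𝓀[K])) :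
    ∃ T : heckeAlgebra R (symplecticSimilitudeGroup (Fin n) K) (symplecticSimilitudeInt (Fin n) K),
      similitudeSatakeTransform hϖ 1 T = f := by
  classical
  suffices H : ∀ (m : ℕ) (f : AddMonoidAlgebra R ((Fin n → ℤ) × ℤ)), f ∈ similitudeTwistedTarget R n (Nat.card 𝓀[K]) →
      (finite_similitudeTwistedDominantBelow f).toFinset.card = m →
      ∃ T : heckeAlgebra R (symplecticSimilitudeGroup (Fin n) K) (symplecticSimilitudeInt (Fin n) K),
        similitudeSatakeTransform hϖ 1 T = f from
    H _ f hf rfl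
  intro m
  induction m using Nat.strong_induction_on with
  | _ m ih =>
  intro f hf hm
  by_cases h0 : f = 0
  · exact ⟨0, by rw [h0, map_zero]⟩
  have hSne : f.coeff.support.Nonempty := by
    rw [Finsupp.support_nonempty_iff, ne_eq, AddMonoidAlgebra.coeff_eq_zero]
    exact h0
  obtain ⟨⟨a₀, c⟩, ha₀⟩ := hSne
  set S : Finset (Fin n → ℤ) := (f.coeff.support.filter fun lc => lc.2 = c).image Prod.fst with hSdef
  have hmemS : ∀ μ, μ ∈ S ↔ f.coeff (μ, c) ≠ 0 := fun μ => by
    rw [hSdef, Finset.mem_image]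
    constructor
    · rintro ⟨⟨μ', c'⟩, h, rfl⟩
      rw [Finset.mem_filter, Finsupp.mem_support_iff] at h
      obtain ⟨h1, rfl⟩ := h
      exact h1
    · intro h
      exact ⟨(μ, c), Finset.mem_filter.2 ⟨Finsupp.mem_support_iff.2 h, rfl⟩, rfl⟩
  have hSne' : S.Nonempty := ⟨a₀, (hmemS a₀).2 (Finsupp.mem_support_iff.1 ha₀)⟩
  obtain ⟨a, haS, hmax⟩ := S.exists_max_image (fun μ => toLex (headSumVec μ)) hSne'
  have haS' : f.coeff (a, c) ≠ 0 := (hmemS a).1 haS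
  obtain ⟨hmono, hdom⟩ := antitone_two_mul_ge_of_isMaxOn_of_mem_twisted hf haS' fun μ hμ => hmax μ ((hmemS μ).2 hμ)
  -- the Cartan operator `T_{t(c, a - c·1)}` and its counting transform `F = x^{(a,c)} + lower terms`
  set a' : Fin n → ℤ := fun i => a i - c with ha'
  have hmono' : Antitone a' := fun i j hij => sub_le_sub_right (hmono hij) _
  have hdom' : ∀ i, 0 ≤ c + 2 * a' i := fun i => by have := hdom i; rw [ha']; dsimp only; linarith
  have haa' : (fun i => c + a' i) = a := funext fun i => by rw [ha']; dsimp only; ring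
  set Ta : heckeAlgebra R (symplecticSimilitudeGroup (Fin n) K) (symplecticSimilitudeInt (Fin n) K) :=
    heckeAlgebra.doubleCosetOperator (symplecticSimilitudeInt (Fin n) K)
      (similitudeTorusElt (uniformizer_ne_zero hϖ) c a' : symplecticSimilitudeGroup (Fin n) K) with hTa
  set F := similitudeSatakeTransform hϖ 1 Ta with hFdef
  have hcF : F.coeff (a, c) = 1 := by
    have h := coeff_self_similitudeSatakeTransform_torusElt hϖ (1 : Rˣ) hmono' hdom'
    rw [haa', _root_.one_zpow, Units.val_one] at h
    exact h
  have hsnd : ∀ μc : (Fin n → ℤ) × ℤ, F.coeff μc ≠ 0 → μc.2 = c := fun μc hμ =>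
    snd_eq_of_coeff_similitudeSatakeTransform_ne_zero hϖ (1 : Rˣ) c a' hμ
  have htri : ∀ μc : (Fin n → ℤ) × ℤ, F.coeff μc ≠ 0 → ∀ r, headSum μc.1 r ≤ headSum a r := fun μc hμ r => by
    have h := headSum_le_of_coeff_similitudeSatakeTransform_ne_zero hϖ (1 : Rˣ) hmono' hdom' hμ r
    rw [headSum_eq, headSum_eq]
    refine h.trans (le_of_eq (Finset.sum_congr rfl fun i _ => ?_))
    rw [← haa']
  have hF : F ∈ similitudeTwistedTarget R n (Nat.card 𝓀[K]) := similitudeSatakeTransform_one_mem_twisted hϖ Ta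
  -- `g = f - f_{(a,c)} F`
  set k : R := f.coeff (a, c) with hk
  set g := f - k • F with hgdef
  have hg : g ∈ similitudeTwistedTarget R n (Nat.card 𝓀[K]) := Submodule.sub_mem _ hf (Submodule.smul_mem _ k hF)
  have hgcoeff : ∀ μc, g.coeff μc = f.coeff μc - k * F.coeff μc := fun μc => by
    rw [hgdef, AddMonoidAlgebra.coeff_sub, AddMonoidAlgebra.coeff_smul, Finsupp.sub_apply, Finsupp.smul_apply, smul_eq_mul]
  have hga : g.coeff (a, c) = 0 := by rw [hgcoeff, hk, hcF, mul_one, sub_self]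
  have hgsupp : ∀ μc, g.coeff μc ≠ 0 → f.coeff μc ≠ 0 ∨ F.coeff μc ≠ 0 := fun μc h => by
    by_contra h'
    rw [not_or, not_ne_iff, not_ne_iff] at h'
    exact h (by rw [hgcoeff, h'.1, h'.2, mul_zero, sub_zero])
  have hsub : similitudeTwistedDominantBelow g ⊆ similitudeTwistedDominantBelow f := by
    rintro ⟨la, c'⟩ ⟨h1, h2, b, hb, hbm, hle⟩
    rcases hgsupp (b, c') hb with hbf | hbF
    · exact ⟨h1, h2, b, hbf, hbm, hle⟩
    · have hc' : c' = c := hsnd (b, c') hbF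
      subst hc'
      exact ⟨h1, h2, a, haS', hmono, fun r => (hle r).trans (htri (b, c') hbF r)⟩
  have haU : (a, c) ∈ similitudeTwistedDominantBelow f := ⟨hmono, hdom, a, haS', hmono, fun _ => le_rfl⟩
  have haU' : (a, c) ∉ similitudeTwistedDominantBelow g := by
    rintro ⟨-, -, b, hb, -, hle⟩
    have hba : a = b := by
      rcases hgsupp (b, c) hb with hbf | hbF
      · exact eq_of_headSum_le_of_toLex_le hle (hmax b ((hmemS b).2 hbf))
      · exact eq_of_headSum_le_antisymm hle (htri (b, c) hbF)
    rw [← hba] at hb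
    exact hb hga
  have hlt : (finite_similitudeTwistedDominantBelow g).toFinset.card < (finite_similitudeTwistedDominantBelow f).toFinset.card :=
    Finset.card_lt_card (Set.Finite.toFinset_ssubset_toFinset.2 ((Set.ssubset_iff_of_subset hsub).2 ⟨(a, c), haU, haU'⟩))
  obtain ⟨T', hT'⟩ := ih _ (hm ▸ hlt) g hg rfl
  refine ⟨T' + k • Ta, ?_⟩
  rw [map_add, map_smul, hT', hgdef, sub_add_cancel]

/-- **`range 𝒮_1 = 𝒯_R`.** [cite: ZhuIntegralSatake2020, §1.4] [cite: TreumannVenkatesh2016, §7.2 Theorem (i)] [cite: GrossSatake1998, (3.10)–(3.11)] -/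
theorem range_similitudeSatakeTransform_one_eq_twisted (hϖ : Valued.v ϖ = WithZero.exp (-1 : ℤ)) :
    LinearMap.range (similitudeSatakeTransform (n := n) (K := K) hϖ (1 : Rˣ)).toLinearMap =
      similitudeTwistedTarget R n (Nat.card 𝓀[K]) := by
  refine le_antisymm ?_ fun f hf => ?_
  · rintro _ ⟨T, rfl⟩
    exact similitudeSatakeTransform_one_mem_twisted hϖ T
  · obtain ⟨T, hT⟩ := exists_similitudeSatakeTransform_one_eq_of_mem_twisted hϖ f hf
    exact ⟨T, hT⟩

/-- **THE COUNTING SATAKE ISOMORPHISM OF `GSp_{2n}` OVER EVERY COMMUTATIVE RING**: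
`𝒮_1 : ℋ(GSp_{2n}(K), GSp_{2n}(𝒪); R) ≃ₗ[R] 𝒯_R` (injective by the tree's `similitudeSatakeTransform_injective_of_commRing`, onto
by the triangular induction) — no inverse of `q` needed. [cite: ZhuIntegralSatake2020, §1.4] [cite: TreumannVenkatesh2016, §7.2 Theorem (i)]
[cite: GrossSatake1998, (3.10)–(3.11), Prop. 3.6] [cite: Herzig2010, Thm. 1.2] -/
def similitudeCountingSatakeLinearEquiv (hϖ : Valued.v ϖ = WithZero.exp (-1 : ℤ)) :
    heckeAlgebra R (symplecticSimilitudeGroup (Fin n) K) (symplecticSimilitudeInt (Fin n) K) ≃ₗ[R]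
      similitudeTwistedTarget R n (Nat.card 𝓀[K]) :=
  LinearEquiv.ofBijective
    ((similitudeSatakeTransform hϖ (1 : Rˣ)).toLinearMap.codRestrict (similitudeTwistedTarget R n (Nat.card 𝓀[K]))
      fun T => similitudeSatakeTransform_one_mem_twisted hϖ T)
    ⟨fun T T' h => similitudeSatakeTransform_injective_of_commRing hϖ 1 (congrArg Subtype.val h),
      fun f => by
        obtain ⟨T, hT⟩ := exists_similitudeSatakeTransform_one_eq_of_mem_twisted hϖ f.1 f.2
        exact ⟨T, Subtype.ext hT⟩⟩

/-- The counting isomorphism is the counting transform. [cite: TreumannVenkatesh2016, §7.2] -/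
@[simp] theorem similitudeCountingSatakeLinearEquiv_apply (hϖ : Valued.v ϖ = WithZero.exp (-1 : ℤ))
    (T : heckeAlgebra R (symplecticSimilitudeGroup (Fin n) K) (symplecticSimilitudeInt (Fin n) K)) :
    ((similitudeCountingSatakeLinearEquiv hϖ T : similitudeTwistedTarget R n (Nat.card 𝓀[K])) :
        AddMonoidAlgebra R ((Fin n → ℤ) × ℤ)) = similitudeSatakeTransform hϖ 1 T := rfl

end Surjective

/-! ## §5 `𝒯_R` versus the `W(GSp_{2n})`-invariants when `q` is a unit -/

section Compare

/-- **`𝒯_R = monomialTwist(q^{⟨ρ,·⟩})⁻¹ (R[ℤⁿ × ℤ]^{W(GSp_{2n})})` when `(q : R) = b` is a unit**: the twisted relations, imposed from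
the dominant end only, are equivalent to the `W`-invariance of `Σ_λ q^{⟨ρ,λ₁⟩} f_λ x^λ`. [cite: TreumannVenkatesh2016, §7.2]
[cite: CartierCorvallis1979, §IV (4.2)] -/
theorem mem_similitudeTwistedTarget_iff_monomialTwist_mem_weylInvariants (q : Rˣ) {b : ℕ} (hq : (q : R) = b)
    (f : AddMonoidAlgebra R ((Fin n → ℤ) × ℤ)) :
    f ∈ similitudeTwistedTarget R n b ↔
      monomialTwist (similitudeSatakeWeight q) f ∈ weylInvariants R ((Fin n → ℤ) × ℤ) (similitudeWeylGroup n) := by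
  rw [mem_similitudeTwistedTarget_iff, mem_weylInvariants_similitudeWeylGroup_iff]
  have hpow : ∀ {r r' : ℤ}, r' ≤ r → ((b : R) ^ (r - r').toNat) * ((q ^ r' : Rˣ) : R) = ((q ^ r : Rˣ) : R) := fun {r r'} h => by
    rw [← hq, ← Units.val_pow_eq_pow_val, ← Units.val_mul, ← zpow_natCast, ← _root_.zpow_add, Int.toNat_of_nonneg (by omega),
      sub_add_cancel]
  constructor
  · intro h ε π lc
    rw [coeff_monomialTwist, coeff_monomialTwist, similitudeSatakeWeight_ofAdd, similitudeSatakeWeight_ofAdd]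
    rcases le_or_gt (symplecticRhoPairing (similitudeSignedPermEquiv ε π lc).1) (symplecticRhoPairing lc.1) with hle | hlt
    · rw [h lc ε π hle, ← hpow hle]; ring
    · have h' := h (similitudeSignedPermEquiv ε π lc) (fun j => ε (π.symm j)) π.symm
        (by rw [similitudeSignedPermEquiv_symm_apply']; exact hlt.le)
      rw [similitudeSignedPermEquiv_symm_apply'] at h'
      rw [h', ← hpow hlt.le]; ring
  · intro h lc ε π hle
    have h' := h ε π lc
    rw [coeff_monomialTwist, coeff_monomialTwist, similitudeSatakeWeight_ofAdd, similitudeSatakeWeight_ofAdd, ← hpow hle] at h'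
    refine (Units.mul_right_inj (q ^ symplecticRhoPairing (similitudeSignedPermEquiv ε π lc).1)).1 ?_
    rw [h']; ring

variable {K : Type*} [Field K] [Valued K ℤᵐ⁰] {ϖ : K} [NeZero n] [CompactSpace 𝒪[K]] [Finite 𝓀[K]]
  [IsHeckeTriple (⊤ : Submonoid (symplecticSimilitudeGroup (Fin n) K)) (symplecticSimilitudeInt (Fin n) K)
    (symplecticSimilitudeInt (Fin n) K)]

/-- **Compatibility of the two Satake isomorphisms**: `monomialTwist(q^{⟨ρ,·⟩}) ∘ 𝒮_1 = 𝒮_q`, i.e. the counting isomorphism followed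
by the twist is `similitudeSatakeAlgEquiv` (when `(q : R) = #𝓀` is a unit). [cite: CartierCorvallis1979, §IV (4.2)] [cite: TreumannVenkatesh2016, §7.2] -/
theorem monomialTwist_similitudeCountingSatakeLinearEquiv (hϖ : Valued.v ϖ = WithZero.exp (-1 : ℤ)) (q : Rˣ)
    (hq : (q : R) = Nat.card 𝓀[K]) (T : heckeAlgebra R (symplecticSimilitudeGroup (Fin n) K) (symplecticSimilitudeInt (Fin n) K)) :
    monomialTwist (similitudeSatakeWeight q)
        ((similitudeCountingSatakeLinearEquiv hϖ T : similitudeTwistedTarget R n (Nat.card 𝓀[K])) :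
          AddMonoidAlgebra R ((Fin n → ℤ) × ℤ)) =
      ((similitudeSatakeAlgEquiv hϖ q hq T : weylInvariants R ((Fin n → ℤ) × ℤ) (similitudeWeylGroup n)) :
        AddMonoidAlgebra R ((Fin n → ℤ) × ℤ)) := by
  rw [similitudeCountingSatakeLinearEquiv_apply, coe_similitudeSatakeAlgEquiv, similitudeSatakeTransform_eq_monomialTwist_comp hϖ q,
    AlgHom.comp_apply, similitudeSatakeTransform_eq]
  congr 1
  exact congrArg (fun w => (isIwasawaExponent_similitude hϖ).satakeTransform w T)
    (MonoidHom.ext fun l => by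
      rw [← ofAdd_toAdd l, similitudeSatakeWeight_ofAdd, _root_.one_zpow, Units.val_one, MonoidHom.one_apply]).symm

end Compare

end Literature.NumberTheory.Automorphic.SymplecticCartan

end
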